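import Summits.QuantumFields.QCD.Theses.PauliWegnerSea
import Literature.MathematicalPhysics.QuantumLattice.OverlapLocality
import Literature.MathematicalPhysics.QuantumLattice.WilsonPropagatorHeavyMass
import Literature.MathematicalPhysics.QuantumLattice.GrassmannIntegralWilsonProofs
import Literature.MathematicalPhysics.QuantumLattice.GaugeGroups

/-!
# Stub `stub_heavyMass` of crux `FibreCofactorDomination` (stmt-QuantumFields-11510)

Line `Sketch-ideator3` (card A `random-refit-second-moment`), route PauliWegnerSea (sub QCD).

Heavy-mass pointwise cofactor bound: for m₀ > 0, m₀ ‖adj(D_W)_{pq}‖ ≤ ‖det D_W‖ (adj = det • D⁻¹ and the tree bound ‖D_W(m)⁻¹_{pq}‖ ≤ 1/m).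
-/

noncomputable section

namespace Summit.QuantumFields.QCD.Theorems.RandomRefit

open scoped BigOperators Matrix
open MeasureTheory Filter Literature.MathematicalPhysics.QuantumFieldTheory
  Literature.MathematicalPhysics.QuantumLattice Literature.Probability.LatticeModels

/-- Heavy-mass pointwise cofactor bound: for `m₀ > 0` every adjugate entry of the `r = 1` Wilson–Dirac matrix satisfies `m₀ ‖adj D_{pq}‖ ≤ ‖det D‖` (from `adj D = det D • D⁻¹` and `‖D⁻¹_{pq}‖ ≤ m₀⁻¹`, tree `norm_inv_wilsonDirac_apply_le`). -/
theorem stub_heavyMass : ∀ (L : ℕ) [NeZero L]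
    (U : GaugeConfig 4 L (Matrix.specialUnitaryGroup (Fin 3) ℂ)) (m₀ : ℝ), 0 < m₀ →
    ∀ p q : TorusSite 4 L × Fin 3 × Fin 4,
      m₀ * ‖(wilsonDirac (fundamentalRep (Fin 3)) U m₀ 1).adjugate p q‖ ≤
        ‖(wilsonDirac (fundamentalRep (Fin 3)) U m₀ 1).det‖ := by
  intro L _ U m₀ hm₀ p q
  obtain ⟨hdet, hb⟩ := norm_inv_wilsonDirac_apply_le (fundamentalRep (Fin 3))
    fundamentalRep_mem_unitaryGroup U hm₀ p q 0
  rw [heavy_prefactor_eq hm₀] at hb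
  set D := wilsonDirac (fundamentalRep (Fin 3)) U m₀ 1
  have hθ0 : (0 : ℝ) ≤ 4 / (m₀ + 4) := by positivity
  have hθ1 : 4 / (m₀ + 4) ≤ 1 := by
    rw [div_le_one (by linarith)]
    linarith
  have hb' : ‖D⁻¹ p q‖ ≤ m₀⁻¹ := by
    refine hb.trans ?_
    calc m₀⁻¹ * (4 / (m₀ + 4)) ^ (p.1 0 - q.1 0).valMinAbs.natAbs ≤ m₀⁻¹ * 1 := by
          gcongr
          exact pow_le_one₀ hθ0 hθ1
      _ = m₀⁻¹ := mul_one _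
  have hadj : D.adjugate = D.det • D⁻¹ := by
    rw [Matrix.inv_def, smul_smul, Ring.mul_inverse_cancel _ (isUnit_iff_ne_zero.2 hdet), one_smul]
  rw [hadj, Matrix.smul_apply, norm_smul]
  calc m₀ * (‖D.det‖ * ‖D⁻¹ p q‖) ≤ m₀ * (‖D.det‖ * m₀⁻¹) := by gcongr
    _ = ‖D.det‖ := by field_simp

end Summit.QuantumFields.QCD.Theorems.RandomRefit

end
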